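import Summits.RiemannHypothesis.RiemannHypothesis.Theorems.ScrewSquaringLawDyadicLandauMellin
import Mathlib.Analysis.Analytic.Order
import Mathlib.Analysis.Analytic.Uniqueness
import Mathlib.Analysis.Calculus.Deriv.Shift
import HarnessLib

/-!
# Doubling of zeros from the doubling defect (stub `stub_doubling` of crux
`ScrewSquaringLaw.DyadicLandau`, stmt-RiemannHypothesis-23894)

Route `ScrewSquaringLaw` (L45), line «DoublingChain», registered stub (M).  `Ψ = zetaScrew`
(Suzuki 2023, arXiv:2206.03682, (1.1)), `R(s) = s⁻²(ξ'/ξ)(½+s)`.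

If the Mellin integrand of the doubling defect `g(x) = 4Ψ(log x) − Ψ(2 log x) + K` converges absolutely
at every `σ > 0`, its transform `F` is holomorphic on `H = {Re s > 0}`
(`Landau.differentiableOn_mellinIoi_of_forall`) and equals `4R(s) − ½R(s/2) + K/s` on `Re s > 2`
(`mellinIoi_doublingDefectLog`).  Clearing denominators, with `Z₁(s) = ξ(½+s)`, `Z₂(s) = ξ(½+s/2)`
(`Z₂' = ½ ξ'(½ + s/2)`) and `G = F·s²`:
`G Z₁ Z₂ = 4 Z₁' Z₂ − 4 Z₁ Z₂' + K s Z₁ Z₂` on `Re s > 2`, hence on `H` by the identity theorem.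
At `s₀ = 2w` with `ξ(½ + w) = 0`, `Re w > 0`: `Z₂(s₀) = 0` with finite order `n ≥ 1`; if `Z₁(s₀) ≠ 0`
then `4 Z₁ Z₂' = Z₂ · (4Z₁' + K s Z₁ − G Z₁)` has order `n − 1` on the left and `≥ n` on the right —
contradiction (`AnalyticAt.analyticOrderAt_deriv_add_one`, `analyticOrderAt_mul`; the order count of
`ZetaScrewThm17Proofs`).  So `ξ(½ + 2w) = 0`: zeros off the line DOUBLE their distance from `½`
(equivalently: the residue `(4/s₀²)(m(½+s₀) − m(½+s₀/2))` of the transform must vanish).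

A DETECTION statement about `ζ`'s own screw function; RH is not proved here and nothing here bears on
the truth of RH.
-/

-- `Summit.RiemannHypothesis.RiemannHypothesis.…` repeats a component by the tree's layout (D-0017).
set_option linter.dupNamespace false

noncomputable section

open Complex Filter Topology Set MeasureTheory

namespace Summit.RiemannHypothesis.RiemannHypothesis.Theorems.ScrewSquaringLaw

open Literature.NumberTheory.LFunctions Literature.NumberTheory.LFunctions.ZetaScrewLandau

/-- **Stub `stub_doubling` (crux `ScrewSquaringLaw.DyadicLandau`): DOUBLING.** If
`(4Ψ(t) − Ψ(2t) + K) e^{-σt} ∈ L¹(0,∞)` for every `σ > 0`, then every zero `½ + w` of `ξ` with `Re w > 0`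
comes with the zero `½ + 2w` (order count at `s₀ = 2w` in the identity
`F s² ξ(½+s) ξ(½+s/2) = 4ξ'(½+s)ξ(½+s/2) − 2ξ(½+s)ξ'(½+s/2) + K s ξ(½+s)ξ(½+s/2)` on `Re s > 0`). -/
theorem stub_doubling :
    ∀ K : ℝ, (∀ σ : ℝ, 0 < σ →
        IntegrableOn (fun t : ℝ ↦ (4 * zetaScrew t - zetaScrew (2 * t) + K) * Real.exp (-σ * t))
          (Ioi 0)) →
      ∀ w : ℂ, 0 < w.re → riemannXi (1 / 2 + w) = 0 → riemannXi (1 / 2 + 2 * w) = 0 := by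
  intro K hInt w hw hzero
  by_contra hne
  -- the doubling defect in the Mellin variable and its transform `F`, holomorphic on `Re s > 0`
  set g : ℝ → ℝ := fun x ↦ 4 * zetaScrew (Real.log x) - zetaScrew (2 * Real.log x) + K with hg_def
  have hg : Measurable g := measurable_doublingDefectLog K
  have hS : ∀ σ' : ℝ, 0 < σ' → IntegrableOn (fun x ↦ g x * x ^ (-(σ' + 1))) (Ioi 1) :=
    fun σ' hσ' ↦ (integrableOn_doublingDefect_iff K σ').2 (hInt σ' hσ')
  set F : ℂ → ℂ := Landau.mellinIoi g with hF_def
  set H : Set ℂ := {s : ℂ | 0 < s.re} with hH_def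
  have hFdiff : DifferentiableOn ℂ F H := Landau.differentiableOn_mellinIoi_of_forall hg hS
  have hHo : IsOpen H := isOpen_lt continuous_const Complex.continuous_re
  have hHpre : IsPreconnected H := (convex_halfSpace_re_gt 0).isPreconnected
  -- `Z₁(s) = ξ(½+s)`, `Z₂(s) = ξ(½+s/2)`
  set Z₁ : ℂ → ℂ := fun s ↦ riemannXi (1 / 2 + s) with hZ₁_def
  set Z₂ : ℂ → ℂ := fun s ↦ riemannXi (1 / 2 + s / 2) with hZ₂_def
  have hZ₁d : Differentiable ℂ Z₁ := differentiable_riemannXi.comp (by fun_prop)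
  have hZ₂d : Differentiable ℂ Z₂ := differentiable_riemannXi.comp (by fun_prop)
  have hZ₁a : ∀ s, AnalyticAt ℂ Z₁ s := fun s ↦ hZ₁d.analyticAt s
  have hZ₂a : ∀ s, AnalyticAt ℂ Z₂ s := fun s ↦ hZ₂d.analyticAt s
  have hderivZ₁ : ∀ s, deriv Z₁ s = deriv riemannXi (1 / 2 + s) := fun s ↦ by
    simp only [hZ₁_def]
    exact deriv_comp_const_add riemannXi (1 / 2) s
  have hderivZ₂ : ∀ s, deriv Z₂ s = 1 / 2 * deriv riemannXi (1 / 2 + s / 2) := by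
    intro s
    have h1 : HasDerivAt (fun s : ℂ ↦ 1 / 2 + s / 2) (1 / 2) s := by
      have := ((hasDerivAt_id s).div_const 2).const_add (1 / 2)
      simpa using this
    have h2 : HasDerivAt riemannXi (deriv riemannXi (1 / 2 + s / 2)) (1 / 2 + s / 2) :=
      (differentiable_riemannXi _).hasDerivAt
    have h3 := h2.comp s h1
    have h4 : deriv Z₂ s = deriv riemannXi (1 / 2 + s / 2) * (1 / 2) := h3.deriv
    rw [h4]
    ring
  -- the identity `G Z₁ Z₂ = 4 Z₁' Z₂ − 4 Z₁ Z₂' + K s Z₁ Z₂` on `H`, `G = F s²`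
  set G : ℂ → ℂ := fun s ↦ F s * s ^ 2 with hG_def
  have hGa : ∀ s ∈ H, AnalyticAt ℂ G s := fun s hs ↦
    ((hFdiff.analyticOnNhd hHo) s hs).mul (analyticAt_id.pow 2)
  set f₁ : ℂ → ℂ := G * Z₁ * Z₂ with hf₁_def
  set f₂ : ℂ → ℂ := fun s ↦ 4 * deriv Z₁ s * Z₂ s - 4 * Z₁ s * deriv Z₂ s + K * s * Z₁ s * Z₂ s
    with hf₂_def
  have hf₁ : AnalyticOnNhd ℂ f₁ H := fun s hs ↦ ((hGa s hs).mul (hZ₁a s)).mul (hZ₂a s)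
  have hf₂ : AnalyticOnNhd ℂ f₂ H := fun s _ ↦
    (((analyticAt_const.mul (hZ₁a s).deriv).mul (hZ₂a s)).sub
      ((analyticAt_const.mul (hZ₁a s)).mul (hZ₂a s).deriv)).add
      (((analyticAt_const.mul analyticAt_id).mul (hZ₁a s)).mul (hZ₂a s))
  have h3H : (3 : ℂ) ∈ H := by simp [hH_def]
  have hev3 : f₁ =ᶠ[𝓝 (3 : ℂ)] f₂ := by
    have hopen : IsOpen {s : ℂ | 2 < s.re} := isOpen_lt continuous_const Complex.continuous_re
    filter_upwards [hopen.mem_nhds (show (3 : ℂ) ∈ {s : ℂ | 2 < s.re} by simp; norm_num)]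
      with s hs
    have hs' : 2 < s.re := hs
    have hξ₁ : riemannXi (1 / 2 + s) ≠ 0 := riemannXi_ne_zero_of_one_le_re (by simp; linarith)
    have hξ₂ : riemannXi (1 / 2 + s / 2) ≠ 0 := riemannXi_ne_zero_of_one_le_re (by simp; linarith)
    have hs0 : s ≠ 0 := fun h ↦ by rw [h, zero_re] at hs'; linarith
    simp only [hf₁_def, hf₂_def, Pi.mul_apply]
    rw [hderivZ₁ s, hderivZ₂ s]
    simp only [hG_def, hZ₁_def, hZ₂_def, hF_def, hg_def]
    rw [mellinIoi_doublingDefectLog K hs', logDeriv_apply, logDeriv_apply]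
    set A : ℂ := riemannXi (1 / 2 + s) with hA
    set B : ℂ := riemannXi (1 / 2 + s / 2) with hB
    set A' : ℂ := deriv riemannXi (1 / 2 + s) with hA'
    set B' : ℂ := deriv riemannXi (1 / 2 + s / 2) with hB'
    field_simp
    ring
  have hEqOn : EqOn f₁ f₂ H := hf₁.eqOn_of_preconnected_of_eventuallyEq hf₂ hHpre h3H hev3
  -- the point `s₀ = 2w`
  set s₀ : ℂ := 2 * w with hs₀_def
  have hs₀H : s₀ ∈ H := by
    show 0 < (2 * w).re
    simp [Complex.mul_re]
    linarith
  have hZ₂0 : Z₂ s₀ = 0 := by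
    show riemannXi (1 / 2 + 2 * w / 2) = 0
    rwa [mul_div_cancel_left₀ w two_ne_zero]
  have hZ₁0 : Z₁ s₀ ≠ 0 := hne
  -- rearranged identity near `s₀`: `4 Z₁ Z₂' = Z₂ · (4 Z₁' + K s Z₁ − G Z₁)`
  set P : ℂ → ℂ := (fun s ↦ (4 : ℂ) * Z₁ s) * deriv Z₂ with hP_def
  set Q' : ℂ → ℂ := fun s ↦ 4 * deriv Z₁ s + K * s * Z₁ s - G s * Z₁ s with hQ'_def
  set Q : ℂ → ℂ := Z₂ * Q' with hQ_def
  have hPQ : P =ᶠ[𝓝 s₀] Q := by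
    filter_upwards [hHo.mem_nhds hs₀H] with s hs
    have h := hEqOn hs
    simp only [hf₁_def, hf₂_def, Pi.mul_apply] at h
    simp only [hP_def, hQ_def, hQ'_def, Pi.mul_apply]
    linear_combination h
  have h4Z₁a : AnalyticAt ℂ (fun s ↦ (4 : ℂ) * Z₁ s) s₀ := analyticAt_const.mul (hZ₁a s₀)
  have hQ'a : AnalyticAt ℂ Q' s₀ :=
    ((analyticAt_const.mul (hZ₁a s₀).deriv).add ((analyticAt_const.mul analyticAt_id).mul
      (hZ₁a s₀))).sub ((hGa s₀ hs₀H).mul (hZ₁a s₀))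
  have h0 : analyticOrderAt (fun s ↦ (4 : ℂ) * Z₁ s) s₀ = 0 :=
    h4Z₁a.analyticOrderAt_eq_zero.2 (mul_ne_zero (by norm_num) hZ₁0)
  -- orders at `s₀`
  have h1 : analyticOrderAt (deriv Z₂) s₀ + 1 = analyticOrderAt Z₂ s₀ := by
    have := (hZ₂a s₀).analyticOrderAt_deriv_add_one
    simpa [hZ₂0] using this
  have h2 : analyticOrderAt (deriv Z₂) s₀ = analyticOrderAt Z₂ s₀ + analyticOrderAt Q' s₀ := by
    have hP' : analyticOrderAt P s₀ = analyticOrderAt (deriv Z₂) s₀ := by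
      rw [hP_def, analyticOrderAt_mul h4Z₁a (hZ₂a s₀).deriv, h0, zero_add]
    rw [← hP', analyticOrderAt_congr hPQ, hQ_def, analyticOrderAt_mul (hZ₂a s₀) hQ'a]
  rw [h2] at h1
  -- `Z₂` is not locally zero (else `ξ ≡ 0`), so its order is finite: contradiction
  generalize hoZ : analyticOrderAt Z₂ s₀ = oZ at h1
  generalize hoQ : analyticOrderAt Q' s₀ = oQ at h1
  cases oZ with
  | top =>
    have hloc : ∀ᶠ s in 𝓝 s₀, Z₂ s = 0 := analyticOrderAt_eq_top.1 hoZ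
    have hall : EqOn Z₂ 0 univ :=
      (hZ₂d.differentiableOn.analyticOnNhd isOpen_univ).eqOn_zero_of_preconnected_of_eventuallyEq_zero
        isPreconnected_univ (Set.mem_univ s₀) hloc
    have h1' : Z₂ 1 = 0 := hall (Set.mem_univ 1)
    simp only [hZ₂_def] at h1'
    exact riemannXi_ne_zero_of_one_le_re (s := 1 / 2 + 1 / 2) (by norm_num) h1'
  | coe n =>
    cases oQ with
    | top => simp at h1
    | coe m =>
      have h' : (n + m + 1 : ℕ) = n := by exact_mod_cast h1
      omega

end Summit.RiemannHypothesis.RiemannHypothesis.Theorems.ScrewSquaringLaw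

end
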